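import Mathlib
import Summits.CriticalPhenomena.Ising3DConformalLimit.Theorems.PrecisionLaplacianDirectCorrelationStableTailScaleRegularityAux
import Summits.CriticalPhenomena.Ising3DConformalLimit.Theorems.PrecisionLaplacianDirectCorrelationStableTailScaleRegularityAux2

/-!
# Slab profile families with Hausdorff modes and a linear transverse gap
# (helpers for stub `stub_scaleRegularity`)

First the two square integrals `∫_Q e^{-b‖k‖} ≤ 16/b²`, `∫_Q ‖k‖e^{-b‖k‖} ≤ 128/b³` and the GAP MOMENT
BOUND for a single summable even profile whose nonnegative cosine transform is dominated by
`A e^{-b‖k‖}` on the square.  Then, for a family of profiles `Φ : ℕ → (ℤ² → ℝ)` (in the application `Φ n y = a(insertNth i n y)`, the slab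
profiles of a lattice function in direction `i`) whose cosine transforms
`Φ̂_n(k) = Σ'_y Φ n y cos(k·y)` are Hausdorff moment sequences in `n ≥ 1` for every `k`
(`Φ̂_n(k) = ∫ t^{n-1} dτ_k`, `τ_k` finite on `[0,1]`) and obey the one-step gap
`Φ̂_{n+1}(k) ≤ e^{-c₀‖k‖} Φ̂_n(k)` on the Brillouin square, we derive, writing `S(m) = Σ'_y Φ m y`:

* `Φ̂_{m+d}(k) ≤ S(m) e^{-c₀ d ‖k‖}` on the square (iterate the gap, `Φ̂_m ≤ S(m)` by `Φ ≥ 0`);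
* (F0) `|Φ (m+d) y| ≤ (2π)⁻² S(m) · 16/(c₀d)²`;
* (F1) `|Φ (m+d) y − Φ (m+d) y'| ≤ (Σ_j|y_j − y'_j|) (2π)⁻² S(m) · 128/(c₀d)³`;
* (F2) `|Φ (m+d+u) y − Φ (m+d+u+1) y| ≤ (2π)⁻² (S(m)/(u+1)) · 16/(c₀d)²`
  (the difference profile has nonnegative transform `∫ t^{n-1}(1-t) dτ_k ≤ Φ̂_{m+d}(k)/(u+1)`).

Pure theorem file, no definitions; every statement is for an arbitrary family `Φ`.
-/

noncomputable section

namespace Summit.CriticalPhenomena.Ising3DConformalLimit.Cruxes.DirectCorrelationStableTail.SelfEnergyPickInversion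

open MeasureTheory Filter Topology Real
open scoped BigOperators

/-! ### Exponential integrals over the Brillouin square -/

/-- **`∫_Q e^{-b‖k‖} dk ≤ 16/b²`** over the Brillouin square, for `b > 0`. -/
theorem integral_box_exp_neg_mul_norm_le {b : ℝ} (hb : 0 < b) :
    ∫ k, Real.exp (-(b * ‖k‖))
        ∂(Measure.pi fun _ : Fin 2 => (volume : Measure ℝ).restrict (Set.Icc (-π) π))
      ≤ 16 / b ^ 2 := by
  have hint : Integrable (fun k : Fin 2 → ℝ => ∏ j, Real.exp (-(b / 2 * |k j|)))
      (Measure.pi fun _ : Fin 2 => (volume : Measure ℝ).restrict (Set.Icc (-π) π)) :=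
    integrable_box_of_continuous (by fun_prop)
  calc ∫ k, Real.exp (-(b * ‖k‖))
        ∂(Measure.pi fun _ : Fin 2 => (volume : Measure ℝ).restrict (Set.Icc (-π) π))
      ≤ ∫ k, ∏ j, Real.exp (-(b / 2 * |k j|))
          ∂(Measure.pi fun _ : Fin 2 => (volume : Measure ℝ).restrict (Set.Icc (-π) π)) :=
        integral_mono_of_nonneg (ae_of_all _ fun _ => (exp_pos _).le) hint
          (ae_of_all _ fun k => exp_neg_mul_norm_le_prod hb.le k)
    _ = ∏ _j : Fin 2, ∫ t in Set.Icc (-π) π, Real.exp (-(b / 2 * |t|)) :=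
        integral_fintype_prod_eq_prod (fun (_ : Fin 2) (t : ℝ) => Real.exp (-(b / 2 * |t|)))
    _ ≤ ∏ _j : Fin 2, 2 / (b / 2) := by
        refine Finset.prod_le_prod (fun _ _ => ?_) fun _ _ => integral_Icc_exp_neg_mul_abs_le (by positivity)
        exact integral_nonneg fun _ => (exp_pos _).le
    _ = 16 / b ^ 2 := by
        rw [Finset.prod_const, Finset.card_univ, Fintype.card_fin]
        field_simp
        norm_num

/-- **`∫_Q ‖k‖ e^{-b‖k‖} dk ≤ 128/b³`** over the Brillouin square, for `b > 0`. -/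
theorem integral_box_norm_mul_exp_neg_mul_norm_le {b : ℝ} (hb : 0 < b) :
    ∫ k, ‖k‖ * Real.exp (-(b * ‖k‖))
        ∂(Measure.pi fun _ : Fin 2 => (volume : Measure ℝ).restrict (Set.Icc (-π) π))
      ≤ 128 / b ^ 3 := by
  have hpt : ∀ u : ℝ, u * Real.exp (-(b * u)) ≤ 2 / b * Real.exp (-(b / 2 * u)) := fun u => by
    have h1 : b / 2 * u ≤ Real.exp (b / 2 * u) := by linarith [Real.add_one_le_exp (b / 2 * u)]
    have h2 : Real.exp (-(b * u)) = Real.exp (-(b / 2 * u)) * Real.exp (-(b / 2 * u)) := by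
      rw [← Real.exp_add]; ring_nf
    rw [h2, ← mul_assoc]
    refine mul_le_mul_of_nonneg_right ?_ (exp_pos _).le
    rw [Real.exp_neg, ← div_eq_mul_inv, div_le_div_iff₀ (exp_pos _) hb]
    nlinarith [exp_pos (b / 2 * u)]
  have hint : Integrable (fun k : Fin 2 → ℝ => 2 / b * Real.exp (-(b / 2 * ‖k‖)))
      (Measure.pi fun _ : Fin 2 => (volume : Measure ℝ).restrict (Set.Icc (-π) π)) :=
    integrable_box_of_continuous (by fun_prop)
  calc ∫ k, ‖k‖ * Real.exp (-(b * ‖k‖))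
        ∂(Measure.pi fun _ : Fin 2 => (volume : Measure ℝ).restrict (Set.Icc (-π) π))
      ≤ ∫ k, 2 / b * Real.exp (-(b / 2 * ‖k‖))
          ∂(Measure.pi fun _ : Fin 2 => (volume : Measure ℝ).restrict (Set.Icc (-π) π)) :=
        integral_mono_of_nonneg (ae_of_all _ fun k => mul_nonneg (norm_nonneg _) (exp_pos _).le) hint
          (ae_of_all _ fun k => hpt ‖k‖)
    _ = 2 / b * ∫ k, Real.exp (-(b / 2 * ‖k‖))
          ∂(Measure.pi fun _ : Fin 2 => (volume : Measure ℝ).restrict (Set.Icc (-π) π)) :=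
        integral_const_mul _ _
    _ ≤ 2 / b * (16 / (b / 2) ^ 2) :=
        mul_le_mul_of_nonneg_left (integral_box_exp_neg_mul_norm_le (by positivity)) (by positivity)
    _ = 128 / b ^ 3 := by
        field_simp
        norm_num

/-! ### Profiles whose cosine transform is dominated by `A e^{-b‖k‖}` on the square -/

/-- **Gap moment bound, axial form.** A summable even profile `φ` on `ℤ²` whose nonnegative cosine
transform is dominated on the square by `A e^{-b‖k‖}` satisfies `|φ(y)| ≤ (2π)⁻² · A · 16/b²`. -/
theorem abs_le_of_cosTransform_le_exp {φ : (Fin 2 → ℤ) → ℝ} (hφ : Summable φ)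
    (heven : ∀ y, φ (-y) = φ y)
    (hpos : ∀ k : Fin 2 → ℝ, 0 ≤ ∑' y, φ y * Real.cos (∑ j, k j * (y j : ℝ)))
    {A b : ℝ} (hA : 0 ≤ A) (hb : 0 < b)
    (hdom : ∀ k : Fin 2 → ℝ, (∀ j, |k j| ≤ π) →
      ∑' y, φ y * Real.cos (∑ j, k j * (y j : ℝ)) ≤ A * Real.exp (-(b * ‖k‖)))
    (y₀ : Fin 2 → ℤ) :
    |φ y₀| ≤ 1 / (2 * π) ^ 2 * (A * (16 / b ^ 2)) := by
  refine (abs_le_integral_cosTransform hφ heven hpos y₀).trans ?_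
  refine mul_le_mul_of_nonneg_left ?_ (by positivity)
  calc ∫ k, (∑' y, φ y * Real.cos (∑ j, k j * (y j : ℝ)))
        ∂(Measure.pi fun _ : Fin 2 => (volume : Measure ℝ).restrict (Set.Icc (-π) π))
      ≤ ∫ k, A * Real.exp (-(b * ‖k‖))
          ∂(Measure.pi fun _ : Fin 2 => (volume : Measure ℝ).restrict (Set.Icc (-π) π)) :=
        integral_mono_of_nonneg (ae_of_all _ hpos) (integrable_box_of_continuous (by fun_prop))
          (ae_box hdom)
    _ = A * ∫ k, Real.exp (-(b * ‖k‖))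
          ∂(Measure.pi fun _ : Fin 2 => (volume : Measure ℝ).restrict (Set.Icc (-π) π)) :=
        integral_const_mul _ _
    _ ≤ A * (16 / b ^ 2) := mul_le_mul_of_nonneg_left (integral_box_exp_neg_mul_norm_le hb) hA

/-- **Gap moment bound, Lipschitz form.** Under the same domination,
`|φ(y) − φ(y')| ≤ (Σ_j |y_j − y'_j|) · (2π)⁻² · A · 128/b³`. -/
theorem abs_sub_le_of_cosTransform_le_exp {φ : (Fin 2 → ℤ) → ℝ} (hφ : Summable φ)
    (heven : ∀ y, φ (-y) = φ y)
    (hpos : ∀ k : Fin 2 → ℝ, 0 ≤ ∑' y, φ y * Real.cos (∑ j, k j * (y j : ℝ)))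
    {A b : ℝ} (hA : 0 ≤ A) (hb : 0 < b)
    (hdom : ∀ k : Fin 2 → ℝ, (∀ j, |k j| ≤ π) →
      ∑' y, φ y * Real.cos (∑ j, k j * (y j : ℝ)) ≤ A * Real.exp (-(b * ‖k‖)))
    (y y' : Fin 2 → ℤ) :
    |φ y - φ y'| ≤ (∑ j, |(y j : ℝ) - y' j|) * (1 / (2 * π) ^ 2 * (A * (128 / b ^ 3))) := by
  refine (abs_sub_le_integral_norm_mul_cosTransform hφ heven hpos y y').trans ?_
  refine mul_le_mul_of_nonneg_left ?_ (Finset.sum_nonneg fun _ _ => abs_nonneg _)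
  refine mul_le_mul_of_nonneg_left ?_ (by positivity)
  calc ∫ k, ‖k‖ * (∑' z, φ z * Real.cos (∑ j, k j * (z j : ℝ)))
        ∂(Measure.pi fun _ : Fin 2 => (volume : Measure ℝ).restrict (Set.Icc (-π) π))
      ≤ ∫ k, A * (‖k‖ * Real.exp (-(b * ‖k‖)))
          ∂(Measure.pi fun _ : Fin 2 => (volume : Measure ℝ).restrict (Set.Icc (-π) π)) := by
        refine integral_mono_of_nonneg (ae_of_all _ fun k => mul_nonneg (norm_nonneg _) (hpos k))
          (integrable_box_of_continuous (by fun_prop)) (ae_box fun k hk => ?_)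
        calc ‖k‖ * (∑' z, φ z * Real.cos (∑ j, k j * (z j : ℝ)))
            ≤ ‖k‖ * (A * Real.exp (-(b * ‖k‖))) :=
              mul_le_mul_of_nonneg_left (hdom k hk) (norm_nonneg _)
          _ = A * (‖k‖ * Real.exp (-(b * ‖k‖))) := by ring
    _ = A * ∫ k, ‖k‖ * Real.exp (-(b * ‖k‖))
          ∂(Measure.pi fun _ : Fin 2 => (volume : Measure ℝ).restrict (Set.Icc (-π) π)) :=
        integral_const_mul _ _
    _ ≤ A * (128 / b ^ 3) :=
        mul_le_mul_of_nonneg_left (integral_box_norm_mul_exp_neg_mul_norm_le hb) hA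

/-! ### Pointwise consequences of the Hausdorff representation -/

/-- Hausdorff modes are nonnegative: `Φ̂_n(k) ≥ 0` for `n ≥ 1`. -/
theorem family_cosTransform_nonneg {Φ : ℕ → (Fin 2 → ℤ) → ℝ}
    (hHaus : ∀ k : Fin 2 → ℝ, ∃ τ : Measure ℝ, IsFiniteMeasure τ ∧ τ (Set.Icc (0 : ℝ) 1)ᶜ = 0 ∧
      ∀ n : ℕ, 1 ≤ n → (∑' y : Fin 2 → ℤ, Φ n y * Real.cos (∑ j, k j * (y j : ℝ))) =
        ∫ t, t ^ (n - 1) ∂τ)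
    {n : ℕ} (hn : 1 ≤ n) (k : Fin 2 → ℝ) :
    0 ≤ ∑' y : Fin 2 → ℤ, Φ n y * Real.cos (∑ j, k j * (y j : ℝ)) := by
  obtain ⟨τ, _, hτ, h⟩ := hHaus k
  rw [h n hn]
  exact moment_nonneg hτ _

/-- Consecutive Hausdorff modes decrease: `Φ̂_n(k) − Φ̂_{n+1}(k) ≥ 0` for `n ≥ 1`. -/
theorem family_cosTransform_sub_nonneg {Φ : ℕ → (Fin 2 → ℤ) → ℝ}
    (hHaus : ∀ k : Fin 2 → ℝ, ∃ τ : Measure ℝ, IsFiniteMeasure τ ∧ τ (Set.Icc (0 : ℝ) 1)ᶜ = 0 ∧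
      ∀ n : ℕ, 1 ≤ n → (∑' y : Fin 2 → ℤ, Φ n y * Real.cos (∑ j, k j * (y j : ℝ))) =
        ∫ t, t ^ (n - 1) ∂τ)
    {n : ℕ} (hn : 1 ≤ n) (k : Fin 2 → ℝ) :
    0 ≤ (∑' y : Fin 2 → ℤ, Φ n y * Real.cos (∑ j, k j * (y j : ℝ))) -
      ∑' y : Fin 2 → ℤ, Φ (n + 1) y * Real.cos (∑ j, k j * (y j : ℝ)) := by
  obtain ⟨τ, hfin, hτ, h⟩ := hHaus k
  rw [h n hn, h (n + 1) (by omega), sub_nonneg]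
  exact moment_anti hτ (by omega)

/-- Difference bound for Hausdorff modes:
`Φ̂_{m+d+u}(k) − Φ̂_{m+d+u+1}(k) ≤ Φ̂_{m+d}(k)/(u+1)` for `m ≥ 1`. -/
theorem family_cosTransform_sub_le {Φ : ℕ → (Fin 2 → ℤ) → ℝ}
    (hHaus : ∀ k : Fin 2 → ℝ, ∃ τ : Measure ℝ, IsFiniteMeasure τ ∧ τ (Set.Icc (0 : ℝ) 1)ᶜ = 0 ∧
      ∀ n : ℕ, 1 ≤ n → (∑' y : Fin 2 → ℤ, Φ n y * Real.cos (∑ j, k j * (y j : ℝ))) =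
        ∫ t, t ^ (n - 1) ∂τ)
    {m : ℕ} (hm : 1 ≤ m) (d u : ℕ) (k : Fin 2 → ℝ) :
    (∑' y : Fin 2 → ℤ, Φ (m + d + u) y * Real.cos (∑ j, k j * (y j : ℝ))) -
        ∑' y : Fin 2 → ℤ, Φ (m + d + u + 1) y * Real.cos (∑ j, k j * (y j : ℝ))
      ≤ (∑' y : Fin 2 → ℤ, Φ (m + d) y * Real.cos (∑ j, k j * (y j : ℝ))) / (u + 1) := by
  obtain ⟨τ, hfin, hτ, h⟩ := hHaus k
  obtain ⟨l, rfl⟩ : ∃ l, m = l + 1 := ⟨m - 1, by omega⟩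
  rw [h _ (by omega), h _ (by omega), h _ (by omega)]
  have e1 : l + 1 + d + u - 1 = (l + d) + u := by omega
  have e2 : l + 1 + d + u + 1 - 1 = (l + d) + u + 1 := by omega
  have e3 : l + 1 + d - 1 = l + d := by omega
  rw [e1, e2, e3]
  exact moment_sub_succ_le hτ (l + d) u

/-- The cosine transform of a nonnegative summable profile is bounded by its sum:
`Φ̂(k) ≤ Σ'_y Φ y`. -/
theorem cosTransform_le_tsum {φ : (Fin 2 → ℤ) → ℝ} (hφ : Summable φ) (hnn : ∀ y, 0 ≤ φ y)
    (k : Fin 2 → ℝ) :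
    ∑' y : Fin 2 → ℤ, φ y * Real.cos (∑ j, k j * (y j : ℝ)) ≤ ∑' y, φ y := by
  refine Summable.tsum_le_tsum (fun y => mul_le_of_le_one_right (hnn y) (Real.cos_le_one _)) ?_ hφ
  exact Summable.of_norm_bounded hφ fun y => by
    rw [Real.norm_eq_abs, abs_mul, abs_of_nonneg (hnn y)]
    exact mul_le_of_le_one_right (hnn y) (Real.abs_cos_le_one _)

/-- **Iterated gap.** On the square, `Φ̂_{m+d}(k) ≤ S(m) e^{-c₀ d ‖k‖}` for `m ≥ 1`, where
`S(m) = Σ'_y Φ m y`. -/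
theorem family_cosTransform_le_sum_mul_exp {Φ : ℕ → (Fin 2 → ℤ) → ℝ} {c₀ : ℝ}
    (hsum : ∀ n, 1 ≤ n → Summable (Φ n)) (hnn : ∀ n, 1 ≤ n → ∀ y, 0 ≤ Φ n y)
    (hGap : ∀ k : Fin 2 → ℝ, (∀ j, |k j| ≤ π) → ∀ n : ℕ, 1 ≤ n →
      (∑' y : Fin 2 → ℤ, Φ (n + 1) y * Real.cos (∑ j, k j * (y j : ℝ))) ≤
        Real.exp (-(c₀ * ‖k‖)) * ∑' y : Fin 2 → ℤ, Φ n y * Real.cos (∑ j, k j * (y j : ℝ)))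
    {m : ℕ} (hm : 1 ≤ m) (d : ℕ) (k : Fin 2 → ℝ) (hk : ∀ j, |k j| ≤ π) :
    ∑' y : Fin 2 → ℤ, Φ (m + d) y * Real.cos (∑ j, k j * (y j : ℝ))
      ≤ (∑' y, Φ m y) * Real.exp (-(c₀ * d * ‖k‖)) := by
  have h1 := le_pow_mul_of_succ_le (M := fun n => ∑' y : Fin 2 → ℤ, Φ n y *
    Real.cos (∑ j, k j * (y j : ℝ))) (exp_pos _).le (hGap k hk) hm d
  have h2 : Real.exp (-(c₀ * ‖k‖)) ^ d = Real.exp (-(c₀ * d * ‖k‖)) := by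
    rw [← Real.exp_nat_mul]; ring_nf
  calc ∑' y : Fin 2 → ℤ, Φ (m + d) y * Real.cos (∑ j, k j * (y j : ℝ))
      ≤ Real.exp (-(c₀ * ‖k‖)) ^ d * ∑' y : Fin 2 → ℤ, Φ m y * Real.cos (∑ j, k j * (y j : ℝ)) := h1
    _ ≤ Real.exp (-(c₀ * ‖k‖)) ^ d * ∑' y, Φ m y :=
        mul_le_mul_of_nonneg_left (cosTransform_le_tsum (hsum m hm) (hnn m hm) k)
          (pow_nonneg (exp_pos _).le d)
    _ = (∑' y, Φ m y) * Real.exp (-(c₀ * d * ‖k‖)) := by rw [h2, mul_comm]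

/-! ### The three profile bounds (F0), (F1), (F2) -/

/-- **(F0) axial gap moment bound**: `|Φ (m+d) y| ≤ (2π)⁻² S(m) · 16/(c₀ d)²` (`m, d ≥ 1`). -/
theorem family_abs_le {Φ : ℕ → (Fin 2 → ℤ) → ℝ} {c₀ : ℝ} (hc₀ : 0 < c₀)
    (hsum : ∀ n, 1 ≤ n → Summable (Φ n)) (heven : ∀ n, 1 ≤ n → ∀ y, Φ n (-y) = Φ n y)
    (hnn : ∀ n, 1 ≤ n → ∀ y, 0 ≤ Φ n y)
    (hHaus : ∀ k : Fin 2 → ℝ, ∃ τ : Measure ℝ, IsFiniteMeasure τ ∧ τ (Set.Icc (0 : ℝ) 1)ᶜ = 0 ∧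
      ∀ n : ℕ, 1 ≤ n → (∑' y : Fin 2 → ℤ, Φ n y * Real.cos (∑ j, k j * (y j : ℝ))) =
        ∫ t, t ^ (n - 1) ∂τ)
    (hGap : ∀ k : Fin 2 → ℝ, (∀ j, |k j| ≤ π) → ∀ n : ℕ, 1 ≤ n →
      (∑' y : Fin 2 → ℤ, Φ (n + 1) y * Real.cos (∑ j, k j * (y j : ℝ))) ≤
        Real.exp (-(c₀ * ‖k‖)) * ∑' y : Fin 2 → ℤ, Φ n y * Real.cos (∑ j, k j * (y j : ℝ)))
    {m d : ℕ} (hm : 1 ≤ m) (hd : 1 ≤ d) (y : Fin 2 → ℤ) :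
    |Φ (m + d) y| ≤ 1 / (2 * π) ^ 2 * ((∑' z, Φ m z) * (16 / (c₀ * d) ^ 2)) :=
  abs_le_of_cosTransform_le_exp (hsum _ (by omega)) (heven _ (by omega))
    (family_cosTransform_nonneg hHaus (by omega)) (tsum_nonneg (hnn m hm)) (by positivity)
    (family_cosTransform_le_sum_mul_exp hsum hnn hGap hm d) y

/-- **(F1) transverse Lipschitz bound**:
`|Φ (m+d) y − Φ (m+d) y'| ≤ (Σ_j |y_j − y'_j|) (2π)⁻² S(m) · 128/(c₀ d)³` (`m, d ≥ 1`). -/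
theorem family_abs_sub_le {Φ : ℕ → (Fin 2 → ℤ) → ℝ} {c₀ : ℝ} (hc₀ : 0 < c₀)
    (hsum : ∀ n, 1 ≤ n → Summable (Φ n)) (heven : ∀ n, 1 ≤ n → ∀ y, Φ n (-y) = Φ n y)
    (hnn : ∀ n, 1 ≤ n → ∀ y, 0 ≤ Φ n y)
    (hHaus : ∀ k : Fin 2 → ℝ, ∃ τ : Measure ℝ, IsFiniteMeasure τ ∧ τ (Set.Icc (0 : ℝ) 1)ᶜ = 0 ∧
      ∀ n : ℕ, 1 ≤ n → (∑' y : Fin 2 → ℤ, Φ n y * Real.cos (∑ j, k j * (y j : ℝ))) =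
        ∫ t, t ^ (n - 1) ∂τ)
    (hGap : ∀ k : Fin 2 → ℝ, (∀ j, |k j| ≤ π) → ∀ n : ℕ, 1 ≤ n →
      (∑' y : Fin 2 → ℤ, Φ (n + 1) y * Real.cos (∑ j, k j * (y j : ℝ))) ≤
        Real.exp (-(c₀ * ‖k‖)) * ∑' y : Fin 2 → ℤ, Φ n y * Real.cos (∑ j, k j * (y j : ℝ)))
    {m d : ℕ} (hm : 1 ≤ m) (hd : 1 ≤ d) (y y' : Fin 2 → ℤ) :
    |Φ (m + d) y - Φ (m + d) y'|
      ≤ (∑ j, |(y j : ℝ) - y' j|) * (1 / (2 * π) ^ 2 * ((∑' z, Φ m z) * (128 / (c₀ * d) ^ 3))) :=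
  abs_sub_le_of_cosTransform_le_exp (hsum _ (by omega)) (heven _ (by omega))
    (family_cosTransform_nonneg hHaus (by omega)) (tsum_nonneg (hnn m hm)) (by positivity)
    (family_cosTransform_le_sum_mul_exp hsum hnn hGap hm d) y y'

/-- **(F2) longitudinal difference bound**:
`|Φ (m+d+u) y − Φ (m+d+u+1) y| ≤ (2π)⁻² (S(m)/(u+1)) · 16/(c₀ d)²` (`m, d ≥ 1`). -/
theorem family_abs_sub_succ_le {Φ : ℕ → (Fin 2 → ℤ) → ℝ} {c₀ : ℝ} (hc₀ : 0 < c₀)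
    (hsum : ∀ n, 1 ≤ n → Summable (Φ n)) (heven : ∀ n, 1 ≤ n → ∀ y, Φ n (-y) = Φ n y)
    (hnn : ∀ n, 1 ≤ n → ∀ y, 0 ≤ Φ n y)
    (hHaus : ∀ k : Fin 2 → ℝ, ∃ τ : Measure ℝ, IsFiniteMeasure τ ∧ τ (Set.Icc (0 : ℝ) 1)ᶜ = 0 ∧
      ∀ n : ℕ, 1 ≤ n → (∑' y : Fin 2 → ℤ, Φ n y * Real.cos (∑ j, k j * (y j : ℝ))) =
        ∫ t, t ^ (n - 1) ∂τ)
    (hGap : ∀ k : Fin 2 → ℝ, (∀ j, |k j| ≤ π) → ∀ n : ℕ, 1 ≤ n →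
      (∑' y : Fin 2 → ℤ, Φ (n + 1) y * Real.cos (∑ j, k j * (y j : ℝ))) ≤
        Real.exp (-(c₀ * ‖k‖)) * ∑' y : Fin 2 → ℤ, Φ n y * Real.cos (∑ j, k j * (y j : ℝ)))
    {m d : ℕ} (hm : 1 ≤ m) (hd : 1 ≤ d) (u : ℕ) (y : Fin 2 → ℤ) :
    |Φ (m + d + u) y - Φ (m + d + u + 1) y|
      ≤ 1 / (2 * π) ^ 2 * ((∑' z, Φ m z) / (u + 1) * (16 / (c₀ * d) ^ 2)) := by
  set ψ : (Fin 2 → ℤ) → ℝ := fun y => Φ (m + d + u) y - Φ (m + d + u + 1) y with hψ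
  have hψsum : Summable ψ := (hsum _ (by omega)).sub (hsum _ (by omega))
  have hψeven : ∀ y, ψ (-y) = ψ y := fun y => by
    simp only [hψ, heven _ (show 1 ≤ m + d + u by omega), heven _ (show 1 ≤ m + d + u + 1 by omega)]
  have hsc : ∀ n, 1 ≤ n → ∀ k : Fin 2 → ℝ,
      Summable fun y : Fin 2 → ℤ => Φ n y * Real.cos (∑ j, k j * (y j : ℝ)) := fun n hn k =>
    Summable.of_norm_bounded (hsum n hn) fun y => by
      rw [Real.norm_eq_abs, abs_mul, abs_of_nonneg (hnn n hn y)]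
      exact mul_le_of_le_one_right (hnn n hn y) (Real.abs_cos_le_one _)
  have hψhat : ∀ k : Fin 2 → ℝ, ∑' y : Fin 2 → ℤ, ψ y * Real.cos (∑ j, k j * (y j : ℝ)) =
      (∑' y : Fin 2 → ℤ, Φ (m + d + u) y * Real.cos (∑ j, k j * (y j : ℝ))) -
        ∑' y : Fin 2 → ℤ, Φ (m + d + u + 1) y * Real.cos (∑ j, k j * (y j : ℝ)) := by
    intro k
    rw [← Summable.tsum_sub (hsc _ (by omega) k) (hsc _ (by omega) k)]
    exact tsum_congr fun y => by simp only [hψ]; ring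
  have hψpos : ∀ k : Fin 2 → ℝ, 0 ≤ ∑' y : Fin 2 → ℤ, ψ y * Real.cos (∑ j, k j * (y j : ℝ)) :=
    fun k => by rw [hψhat]; exact family_cosTransform_sub_nonneg hHaus (by omega) k
  have hA : 0 ≤ (∑' z, Φ m z) / (u + 1) := div_nonneg (tsum_nonneg (hnn m hm)) (by positivity)
  have hdom : ∀ k : Fin 2 → ℝ, (∀ j, |k j| ≤ π) →
      ∑' y : Fin 2 → ℤ, ψ y * Real.cos (∑ j, k j * (y j : ℝ)) ≤
        (∑' z, Φ m z) / (u + 1) * Real.exp (-(c₀ * d * ‖k‖)) := by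
    intro k hk
    rw [hψhat]
    refine (family_cosTransform_sub_le hHaus hm d u k).trans ?_
    rw [div_mul_eq_mul_div]
    exact div_le_div_of_nonneg_right (family_cosTransform_le_sum_mul_exp hsum hnn hGap hm d k hk)
      (by positivity)
  have := abs_le_of_cosTransform_le_exp hψsum hψeven hψpos hA (by positivity : 0 < c₀ * d) hdom y
  simpa only [hψ] using this

/-! ### Positivity and summability of the slab sums -/

/-- **Slab sums are positive.** If the modes are Hausdorff moment sequences and the slab sums
`S(n) = Σ'_y Φ n y` satisfy `c/2 ≤ S(n) n^p` for `n ≥ N` with `c > 0`, then `S(n) > 0` for EVERY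
`n ≥ 1` (the moments `S(n) = ∫ t^{n-1} dτ₀` are non-increasing). -/
theorem family_sum_pos {Φ : ℕ → (Fin 2 → ℤ) → ℝ}
    (hHaus : ∀ k : Fin 2 → ℝ, ∃ τ : Measure ℝ, IsFiniteMeasure τ ∧ τ (Set.Icc (0 : ℝ) 1)ᶜ = 0 ∧
      ∀ n : ℕ, 1 ≤ n → (∑' y : Fin 2 → ℤ, Φ n y * Real.cos (∑ j, k j * (y j : ℝ))) =
        ∫ t, t ^ (n - 1) ∂τ)
    {c p : ℝ} (hc : 0 < c) {N : ℕ} (hlow : ∀ n, N ≤ n → c / 2 ≤ (∑' y, Φ n y) * (n : ℝ) ^ p)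
    {n : ℕ} (hn : 1 ≤ n) : 0 < ∑' y, Φ n y := by
  obtain ⟨τ, hfin, hτ, h⟩ := hHaus 0
  have h0 : ∀ m, 1 ≤ m → ∑' y, Φ m y = ∫ t, t ^ (m - 1) ∂τ := fun m hm => by
    simpa using h m hm
  set m : ℕ := max n (max N 1) with hm
  have hm_pos : 0 < ∑' y, Φ m y := by
    have h1 := hlow m (by omega)
    by_contra hle
    push Not at hle
    have : (∑' y, Φ m y) * (m : ℝ) ^ p ≤ 0 :=
      mul_nonpos_of_nonpos_of_nonneg hle (Real.rpow_nonneg (Nat.cast_nonneg _) _)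
    linarith
  calc 0 < ∑' y, Φ m y := hm_pos
    _ = ∫ t, t ^ (m - 1) ∂τ := h0 m (by omega)
    _ ≤ ∫ t, t ^ (n - 1) ∂τ := moment_anti hτ (by omega)
    _ = ∑' y, Φ n y := (h0 n hn).symm

/-- **Slab profiles are summable** under the same hypotheses (a non-summable `tsum` would vanish). -/
theorem family_summable {Φ : ℕ → (Fin 2 → ℤ) → ℝ}
    (hHaus : ∀ k : Fin 2 → ℝ, ∃ τ : Measure ℝ, IsFiniteMeasure τ ∧ τ (Set.Icc (0 : ℝ) 1)ᶜ = 0 ∧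
      ∀ n : ℕ, 1 ≤ n → (∑' y : Fin 2 → ℤ, Φ n y * Real.cos (∑ j, k j * (y j : ℝ))) =
        ∫ t, t ^ (n - 1) ∂τ)
    {c p : ℝ} (hc : 0 < c) {N : ℕ} (hlow : ∀ n, N ≤ n → c / 2 ≤ (∑' y, Φ n y) * (n : ℝ) ^ p)
    {n : ℕ} (hn : 1 ≤ n) : Summable (Φ n) := by
  by_contra hs
  have h0 := tsum_eq_zero_of_not_summable hs
  have := family_sum_pos hHaus hc hlow hn
  rw [h0] at this
  exact lt_irrefl _ this

/-! ### Registered helper sub-goal -/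

/-- **Registered helper sub-goal `stub_scaleRegularity_auxGapMoment`** of stub `stub_scaleRegularity`
(line `self-energy-pick-inversion`, crux stmt-CriticalPhenomena-4799): the GAP MOMENT BOUND — a summable
even profile `φ : ℤ² → ℝ` whose nonnegative cosine transform is dominated by `A e^{-b‖k‖}` on the
Brillouin square satisfies `|φ(y)| ≤ (2π)⁻² A · 16/b²` and
`|φ(y) − φ(y')| ≤ (Σ_j |y_j − y'_j|) (2π)⁻² A · 128/b³`. -/
theorem stub_scaleRegularity_auxGapMoment :
    ∀ (φ : (Fin 2 → ℤ) → ℝ) (A b : ℝ), Summable φ → (∀ y, φ (-y) = φ y) →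
    (∀ k : Fin 2 → ℝ, 0 ≤ ∑' y : Fin 2 → ℤ, φ y * Real.cos (∑ j, k j * (y j : ℝ))) → 0 ≤ A → 0 < b →
    (∀ k : Fin 2 → ℝ, (∀ j, |k j| ≤ Real.pi) → ∑' y : Fin 2 → ℤ, φ y * Real.cos (∑ j, k j * (y j :
      ℝ)) ≤ A * Real.exp (-(b * ‖k‖))) →
    ∀ y y' : Fin 2 → ℤ, |φ y| ≤ 1 / (2 * Real.pi) ^ 2 * (A * (16 / b ^ 2)) ∧
      |φ y - φ y'| ≤ (∑ j, |(y j : ℝ) - y' j|) * (1 / (2 * Real.pi) ^ 2 * (A * (128 / b ^ 3))) :=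
  fun _φ _A _b hφ heven hpos hA hb hdom y y' =>
    ⟨abs_le_of_cosTransform_le_exp hφ heven hpos hA hb hdom y,
      abs_sub_le_of_cosTransform_le_exp hφ heven hpos hA hb hdom y y'⟩

/-- **Registered helper sub-goal `stub_scaleRegularity_auxExpIntegral`** of stub `stub_scaleRegularity`
(line `self-energy-pick-inversion`, crux stmt-CriticalPhenomena-4799): the two exponential integrals
over the Brillouin square that turn the linear transverse gap into power decay,
`∫_Q e^{-b‖k‖} dk ≤ 16/b²` and `∫_Q ‖k‖ e^{-b‖k‖} dk ≤ 128/b³` (`b > 0`, sup norm). -/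
theorem stub_scaleRegularity_auxExpIntegral :
    ∀ b : ℝ, 0 < b →
    (∫ k, Real.exp (-(b * ‖k‖)) ∂(MeasureTheory.Measure.pi fun _ : Fin 2 =>
      (MeasureTheory.volume : MeasureTheory.Measure ℝ).restrict (Set.Icc (-Real.pi) Real.pi)))
        ≤ 16 / b ^ 2 ∧
    (∫ k, ‖k‖ * Real.exp (-(b * ‖k‖)) ∂(MeasureTheory.Measure.pi fun _ : Fin 2 =>
      (MeasureTheory.volume : MeasureTheory.Measure ℝ).restrict (Set.Icc (-Real.pi) Real.pi)))
        ≤ 128 / b ^ 3 :=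
  fun _b hb => ⟨integral_box_exp_neg_mul_norm_le hb, integral_box_norm_mul_exp_neg_mul_norm_le hb⟩

end Summit.CriticalPhenomena.Ising3DConformalLimit.Cruxes.DirectCorrelationStableTail.SelfEnergyPickInversion

end
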